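import Literature.Analysis.FluidPDE.LocalLerayWeakStrongViscosity
import Literature.Analysis.FluidPDE.LocalLeraySolutionsSlab
import HarnessLib

/-!
# Local Leray solutions on a slab under the viscosity scaling

Analysis/FluidPDE proof file (no new definitions, no named facts), the slab twin of
`LocalLerayViscosityScaling.lean` / `LocalLerayWeakStrongViscosity.lean`. Lemarié-Rieusset's local
Leray theory (*The Navier–Stokes Problem in the 21st Century* (2016), Ch. 14–15, Def. 14.1: local
Leray solutions **on a slab** `(0, T) × ℝ³`) is printed for every viscosity `ν > 0`, whereas the
far-field statements of Kang–Miura–Tsai, Kikuchi–Seregin, Rusin–Šverák and Jia–Šverák that the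
tree vendors as named facts are printed at `ν = 1`. The link is the elementary scaling
`v(t, x) = α V(α t, x)`, `p(t, x) = α² P₁(α t, x)` (Rusin–Šverák 2011, §1; Tao 2013, footnote 3),
which maps solutions with viscosity `μ` on the slab `(0, α T') × ℝ³` to solutions with viscosity
`α μ` on the slab `(0, T') × ℝ³`. This file **proves**, for the tree's slab class
`IsLocalLeraySolutionOn` (`LocalLeraySolutionsSlab.lean`; Def. 14.1 with Kang–Miura–Tsai's clauses):

* `IsLocalLeraySolutionOn.viscosityRescale` — `IsLocalLeraySolutionOn (α T') μ U₀ V P₁` implies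
  `IsLocalLeraySolutionOn T' (α μ) (α U₀) (α V(α ·, ·)) (α² P₁(α ·, ·))` for `α > 0`: every clause
  is transported along the time dilation `Φ(s, y) = (α s, y)`, which pulls the open slab
  `(0, α T') × ℝ³` back to `(0, T') × ℝ³` (the accepted `IsSuitableWeakSolutionOn.stRescale`,
  `HasWeakSpatialGradientOn.stRescale` with `γ = 1`, and the changes of variables of
  `SpaceTimeRescaling.lean`; unlike the global class, whose uniformly local bounds live on the
  parabolic cylinders `(0, R²) × B_R(x₀)` and need an enlarged radius, the slab clauses live on
  `(0, T) × B_R(x₀)` and transport with the same radius);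
* `IsLocalLeraySolutionOn.timeRescale`, `IsLocalLeraySolutionOn.toUnitViscosity` — the same in the
  `timeRescale` notation of the Kato side: a local Leray solution on `(0, T)` with viscosity
  `ν > 0` and datum `v₀` yields the unit-viscosity local Leray solution `ν⁻¹ v(ν⁻¹ ·, ·)`,
  `ν⁻² π(ν⁻¹ ·, ·)` on `(0, ν T)` with datum `ν⁻¹ • v₀`;
* `IsLocalLeraySolutionOn.ofUnitViscosity` — conversely, a unit-viscosity solution on `(0, ν T)`
  with datum `ν⁻¹ • v₀` scales back to viscosity `ν` on `(0, T)`.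

## References

* W. Rusin, V. Šverák, J. Funct. Anal. 260 (2011) = arXiv:0911.0500, §1 p. 3 (unit viscosity).
* T. Tao, Anal. PDE 6 (2013) = arXiv:1108.1165, footnote 3 (viscosity rescaling).
* P. G. Lemarié-Rieusset, *The Navier–Stokes Problem in the 21st Century* (2016),
  doi:10.1201/b19556, Def. 14.1 (PDF pp. 498–499; the class on `(0, T) × ℝ³` for every `ν > 0`).
* K. Kang, H. Miura, T.-P. Tsai, IMRN 2021 = arXiv:1812.10509, Def. 3.2.
-/

noncomputable section

open MeasureTheory TopologicalSpace Set Function Filter Metric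
open _root_.Topology
open scoped ENNReal NNReal RealInnerProductSpace

namespace Literature.Analysis.FluidPDE

/-! ### The time dilation `Φ(s, y) = (α s, y)` on slabs -/

/-- The time dilation pulls the open slab `(0, α T') × ℝ³` back to `(0, T') × ℝ³` (`α > 0`). [folklore] -/
theorem stPreimage_slab_Ioo {α : ℝ} (hα : 0 < α) (T' : ℝ) :
    stPreimage α 1 0 (0 : EuclideanSpace ℝ (Fin 3))
        (slab (EuclideanSpace ℝ (Fin 3)) (Ioo 0 (α * T')) isOpen_Ioo) =
      slab (EuclideanSpace ℝ (Fin 3)) (Ioo 0 T') isOpen_Ioo := by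
  ext z
  simp only [coe_stPreimage, mem_preimage, SetLike.mem_coe, mem_slab, stAffine_fst, zero_add,
    mem_Ioo]
  constructor
  · rintro ⟨h1, h2⟩
    exact ⟨(mul_pos_iff_of_pos_left hα).1 h1, lt_of_mul_lt_mul_left h2 hα.le⟩
  · rintro ⟨h1, h2⟩
    exact ⟨mul_pos hα h1, mul_lt_mul_of_pos_left h2 hα⟩

/-- `Φ⁻¹((0, α T') × K) = (0, T') × K` for the time dilation `Φ(s, y) = (α s, y)`. [folklore] -/
theorem stAffine_preimage_Ioo_zero_prod {α : ℝ} (hα : 0 < α) (T' : ℝ)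
    (K : Set (EuclideanSpace ℝ (Fin 3))) :
    stAffine α 1 0 (0 : EuclideanSpace ℝ (Fin 3)) ⁻¹' (Ioo 0 (α * T') ×ˢ K) = Ioo 0 T' ×ˢ K := by
  have h1 := stAffine_preimage_Ioo_prod hα 0 T' K
  rwa [mul_zero] at h1

/-! ### Local Leray solutions on a slab under the viscosity scaling -/

/-- **Covariance of local Leray solutions on a slab under the viscosity scaling** (Rusin–Šverák
2011, §1; Tao 2013, footnote 3; the class of Lemarié-Rieusset 2016 Def. 14.1 / Kang–Miura–Tsai
Def. 3.2 is written for any viscosity and any slab). If `(V, P₁)` is a local Leray solution on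
the slab `(0, α T') × ℝ³` with viscosity `μ` and datum `U₀`
(`IsLocalLeraySolutionOn (α * T') μ U₀ V P₁`, `α > 0`), then the pair `v(t, x) = α V(α t, x)`,
`p(t, x) = α² P₁(α t, x)` is a local Leray solution on `(0, T') × ℝ³` with viscosity `α μ` and
datum `α U₀`: the suitable weak formulation is covariant (`IsSuitableWeakSolutionOn.stRescale`
with space dilation `γ = 1`, the slab `(0, α T')` pulling back to `(0, T')`), as is the weak
spatial gradient `α ∇V(α ·, ·)`; the local and uniformly local `L²`/`L^{3/2}` bounds on
`(0, T') × K`, the attainment of the datum in `L²_loc` and the decay at spatial infinity are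
transported by the change of variables `t = α s`.
[cite: RusinSverak2011, §1 (arXiv:0911.0500 p. 3, unit viscosity)] -/
theorem IsLocalLeraySolutionOn.viscosityRescale {T' μ : ℝ}
    {U₀ : EuclideanSpace ℝ (Fin 3) → EuclideanSpace ℝ (Fin 3)}
    {V : ℝ → EuclideanSpace ℝ (Fin 3) → EuclideanSpace ℝ (Fin 3)}
    {P₁ : ℝ → EuclideanSpace ℝ (Fin 3) → ℝ} {α : ℝ} (hα : 0 < α)
    (h : IsLocalLeraySolutionOn (α * T') μ U₀ V P₁) :
    IsLocalLeraySolutionOn T' (α * μ) (α • U₀)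
      (α • stPull α 1 0 (0 : EuclideanSpace ℝ (Fin 3)) V)
      (α ^ 2 • stPull α 1 0 (0 : EuclideanSpace ℝ (Fin 3)) P₁) := by
  have hβ : α = α * 1 := (mul_one α).symm
  -- the Jacobian constant of `Φ(s, y) = (α s, y)`
  have hJ : ENNReal.ofReal (α * (1 : ℝ) ^ Module.finrank ℝ (EuclideanSpace ℝ (Fin 3)))⁻¹ =
      ENNReal.ofReal α⁻¹ := by
    rw [one_pow, mul_one]
  -- pointwise form of the rescaled velocity
  have hv : ∀ t x, (α • stPull α 1 0 (0 : EuclideanSpace ℝ (Fin 3)) V) t x = α • V (α * t) x :=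
    fun t x => by rw [smul_stPull_apply, zero_add, zero_add, one_smul]
  refine
    { suitable := ?_
      sqIntegrable := ?_
      pressure := ?_
      uniformLocalEnergy := ?_
      uniformLocalGradient := ?_
      initial := ?_
      decay := ?_ }
  · -- (1)+(4): suitability is covariant, the slab `(0, α T')` pulling back to `(0, T')`
    have hs := h.suitable.stRescale hα one_pos hβ 0 (0 : EuclideanSpace ℝ (Fin 3))
    rw [stPreimage_slab_Ioo hα, div_one] at hs
    have hf : ((α ^ 2 * (1 : ℝ)) • stPull α 1 0 (0 : EuclideanSpace ℝ (Fin 3))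
        (0 : ℝ → EuclideanSpace ℝ (Fin 3) → EuclideanSpace ℝ (Fin 3))) = 0 := by
      funext s y
      simp [stPull]
    rw [hf] at hs
    exact hs
  · -- `v ∈ L²((0, T') × K)`
    intro K hK
    have h1 := setLIntegral_enorm_pow_stRescale hα one_pos 0 (0 : EuclideanSpace ℝ (Fin 3)) α V
      (Ioo 0 (α * T') ×ˢ K) 2
    rw [stAffine_preimage_Ioo_zero_prod hα, hJ] at h1
    rw [h1]
    exact ENNReal.mul_lt_top (ENNReal.mul_lt_top (ENNReal.pow_lt_top enorm_lt_top)
      ENNReal.ofReal_lt_top) (h.sqIntegrable K hK)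
  · -- `p ∈ L^{3/2}((0, T') × K)`
    intro K hK
    have h1 := setLIntegral_enorm_rpow_stRescale hα one_pos 0 (0 : EuclideanSpace ℝ (Fin 3))
      (α ^ 2) P₁ (Ioo 0 (α * T') ×ˢ K) (r := 3 / 2) (by norm_num)
    rw [stAffine_preimage_Ioo_zero_prod hα, hJ] at h1
    rw [h1]
    exact ENNReal.mul_lt_top (ENNReal.mul_lt_top
      (ENNReal.rpow_lt_top_of_nonneg (by norm_num) enorm_ne_top) ENNReal.ofReal_lt_top)
      (h.pressure K hK)
  · -- (2), first half: uniformly local energy, a.e. in `t ∈ (0, T')`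
    intro R hR
    obtain ⟨C, hC⟩ := h.uniformLocalEnergy R hR
    have hC' : ∀ᵐ t ∂(volume.restrict (Ioo (0 + α * 0) (0 + α * T'))),
        ∀ x₀ : EuclideanSpace ℝ (Fin 3), ∫⁻ x in ball x₀ R, ‖V t x‖ₑ ^ 2 ≤ C := by
      have e : Ioo (0 + α * 0) (0 + α * T') = Ioo 0 (α * T') := by
        rw [mul_zero, add_zero, zero_add]
      rw [e]
      exact hC
    have h2 := ae_restrict_Ioo_comp_time_affine hα 0 0 T' hC'
    set C₁ : ℝ≥0∞ := ‖α‖ₑ ^ 2 * C with hC₁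
    have hC₁top : C₁ ≠ ∞ :=
      ENNReal.mul_ne_top (ENNReal.pow_ne_top enorm_ne_top) ENNReal.coe_ne_top
    refine ⟨C₁.toNNReal, ?_⟩
    rw [ENNReal.coe_toNNReal hC₁top]
    filter_upwards [h2] with t ht x₀
    have e1 : ∀ x, ‖(α • stPull α 1 0 (0 : EuclideanSpace ℝ (Fin 3)) V) t x‖ₑ ^ 2 =
        ‖α‖ₑ ^ 2 * ‖V (α * t) x‖ₑ ^ 2 := fun x => by
      rw [hv, enorm_smul, mul_pow]
    simp_rw [e1]
    rw [lintegral_const_mul' _ _ (ENNReal.pow_ne_top enorm_ne_top)]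
    refine mul_le_mul' le_rfl ?_
    simpa only [zero_add] using ht x₀
  · -- (2), second half: the weak spatial gradient `α ∇V(α ·, ·)` on the slab `(0, T')`
    obtain ⟨G, hG, hGb⟩ := h.uniformLocalGradient
    refine ⟨(α * 1) • stPull α 1 0 (0 : EuclideanSpace ℝ (Fin 3)) G, ?_, ?_⟩
    · have h1 := hG.stRescale α hα one_pos 0 (0 : EuclideanSpace ℝ (Fin 3))
      rw [stPreimage_slab_Ioo hα] at h1
      exact h1
    · intro R hR
      obtain ⟨C, hC⟩ := hGb R hR
      set C₁ : ℝ≥0∞ := ENNReal.ofReal ((α * 1) ^ 2) * ENNReal.ofReal α⁻¹ * C with hC₁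
      have hC₁top : C₁ ≠ ∞ :=
        ENNReal.mul_ne_top (ENNReal.mul_ne_top ENNReal.ofReal_ne_top ENNReal.ofReal_ne_top)
          ENNReal.coe_ne_top
      refine ⟨C₁.toNNReal, fun x₀ => ?_⟩
      rw [ENNReal.coe_toNNReal hC₁top]
      have h1 := setLIntegral_frobeniusNormSq_stRescale hα one_pos 0
        (0 : EuclideanSpace ℝ (Fin 3)) (α * 1) G (Ioo 0 (α * T') ×ˢ ball x₀ R)
      rw [stAffine_preimage_Ioo_zero_prod hα, hJ] at h1
      rw [h1]
      exact mul_le_mul' le_rfl (hC x₀)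
  · -- (3): the datum `α U₀` is attained in `L²_loc`
    intro K hK
    have e1 : ∀ t, ∫⁻ x in K, ‖(α • stPull α 1 0 (0 : EuclideanSpace ℝ (Fin 3)) V) t x -
        (α • U₀) x‖ₑ ^ 2 = ‖α‖ₑ ^ 2 * ∫⁻ x in K, ‖V (α * t) x - U₀ x‖ₑ ^ 2 := by
      intro t
      have e2 : ∀ x, ‖(α • stPull α 1 0 (0 : EuclideanSpace ℝ (Fin 3)) V) t x - (α • U₀) x‖ₑ ^ 2 =
          ‖α‖ₑ ^ 2 * ‖V (α * t) x - U₀ x‖ₑ ^ 2 := fun x => by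
        rw [hv, Pi.smul_apply, ← smul_sub, enorm_smul, mul_pow]
      simp_rw [e2]
      rw [lintegral_const_mul' _ _ (ENNReal.pow_ne_top enorm_ne_top)]
    simp_rw [e1]
    have hmap : Tendsto (fun t : ℝ => α * t) (𝓝[>] (0 : ℝ)) (𝓝[>] (0 : ℝ)) := by
      have h1 : Tendsto (fun t : ℝ => α * t) (𝓝 0) (𝓝 (α * 0)) :=
        (continuous_const_mul α).tendsto 0
      rw [mul_zero] at h1
      refine tendsto_nhdsWithin_of_tendsto_nhds_of_eventually_within _
        (h1.mono_left nhdsWithin_le_nhds) ?_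
      filter_upwards [self_mem_nhdsWithin] with t ht
      exact mul_pos hα ht
    have h2 := (h.initial K hK).comp hmap
    have h3 := ENNReal.Tendsto.const_mul h2 (Or.inr (ENNReal.pow_ne_top enorm_ne_top) :
      (0 : ℝ≥0∞) ≠ 0 ∨ ‖α‖ₑ ^ 2 ≠ ∞)
    rw [mul_zero] at h3
    exact h3
  · -- (7): decay at spatial infinity on `(0, T') × B_R(x₀)`
    intro R hR
    have heq : ∀ x₀ : EuclideanSpace ℝ (Fin 3),
        ∫⁻ z in Ioo 0 T' ×ˢ ball x₀ R,
            ‖(α • stPull α 1 0 (0 : EuclideanSpace ℝ (Fin 3)) V) z.1 z.2‖ₑ ^ 2 =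
          ‖α‖ₑ ^ 2 * ENNReal.ofReal α⁻¹ *
            ∫⁻ z in Ioo 0 (α * T') ×ˢ ball x₀ R, ‖V z.1 z.2‖ₑ ^ 2 := by
      intro x₀
      have h1 := setLIntegral_enorm_pow_stRescale hα one_pos 0 (0 : EuclideanSpace ℝ (Fin 3)) α V
        (Ioo 0 (α * T') ×ˢ ball x₀ R) 2
      rwa [stAffine_preimage_Ioo_zero_prod hα, hJ] at h1
    simp_rw [heq]
    have h2 := ENNReal.Tendsto.const_mul (h.decay R hR)
      (Or.inr (ENNReal.mul_ne_top (ENNReal.pow_ne_top enorm_ne_top) ENNReal.ofReal_ne_top) :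
        (0 : ℝ≥0∞) ≠ 0 ∨ ‖α‖ₑ ^ 2 * ENNReal.ofReal α⁻¹ ≠ ∞)
    rw [mul_zero] at h2
    exact h2

/-- **Viscosity scaling of slab local Leray solutions, `timeRescale` form**: for `a > 0`,
`IsLocalLeraySolutionOn (a * T') ν v₀ v π` implies
`IsLocalLeraySolutionOn T' (a ν) (a • v₀) (a v(a ·, ·)) (a² π(a ·, ·))`
(`IsLocalLeraySolutionOn.viscosityRescale` rewritten with `timeRescale a a v = a • stPull a 1 0 0 v`).
[cite: RusinSverak2011, §1 (arXiv:0911.0500 p. 3, unit viscosity)] -/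
theorem IsLocalLeraySolutionOn.timeRescale {T' ν a : ℝ}
    {v₀ : EuclideanSpace ℝ (Fin 3) → EuclideanSpace ℝ (Fin 3)}
    {v : ℝ → EuclideanSpace ℝ (Fin 3) → EuclideanSpace ℝ (Fin 3)}
    {π : ℝ → EuclideanSpace ℝ (Fin 3) → ℝ} (h : IsLocalLeraySolutionOn (a * T') ν v₀ v π)
    (ha : 0 < a) :
    IsLocalLeraySolutionOn T' (a * ν) (a • v₀) (FluidPDE.timeRescale a a v)
      (FluidPDE.timeRescale a (a ^ 2) π) := by
  rw [← smul_stPull_eq_timeRescale, ← smul_stPull_eq_timeRescale_pressure]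
  exact h.viscosityRescale ha

/-- **Normalisation of a slab local Leray solution to unit viscosity**: a local Leray solution
on `(0, T) × ℝ³` with viscosity `ν > 0` and datum `v₀` yields the unit-viscosity local Leray
solution `ν⁻¹ v(ν⁻¹ ·, ·)`, `ν⁻² π(ν⁻¹ ·, ·)` on `(0, ν T) × ℝ³` with datum `ν⁻¹ • v₀`
(Rusin–Šverák 2011, §1 p. 3). [cite: RusinSverak2011, §1 (arXiv:0911.0500 p. 3, unit viscosity)] -/
theorem IsLocalLeraySolutionOn.toUnitViscosity {T ν : ℝ}
    {v₀ : EuclideanSpace ℝ (Fin 3) → EuclideanSpace ℝ (Fin 3)}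
    {v : ℝ → EuclideanSpace ℝ (Fin 3) → EuclideanSpace ℝ (Fin 3)}
    {π : ℝ → EuclideanSpace ℝ (Fin 3) → ℝ} (h : IsLocalLeraySolutionOn T ν v₀ v π) (hν : 0 < ν) :
    IsLocalLeraySolutionOn (ν * T) 1 (ν⁻¹ • v₀) (FluidPDE.timeRescale ν⁻¹ ν⁻¹ v)
      (FluidPDE.timeRescale ν⁻¹ (ν⁻¹ ^ 2) π) := by
  have h' : IsLocalLeraySolutionOn (ν⁻¹ * (ν * T)) ν v₀ v π := by
    rwa [← mul_assoc, inv_mul_cancel₀ hν.ne', one_mul]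
  have h1 := h'.timeRescale (inv_pos.2 hν)
  rwa [inv_mul_cancel₀ hν.ne'] at h1

/-- **Back to viscosity `ν`**: a unit-viscosity local Leray solution `(w, ϖ)` on `(0, ν T) × ℝ³`
with datum `ν⁻¹ • v₀` scales back to the local Leray solution `ν w(ν ·, ·)`, `ν² ϖ(ν ·, ·)` on
`(0, T) × ℝ³` with viscosity `ν` and datum `v₀`. [cite: RusinSverak2011, §1 (arXiv:0911.0500 p. 3, unit viscosity)] -/
theorem IsLocalLeraySolutionOn.ofUnitViscosity {T ν : ℝ}
    {v₀ : EuclideanSpace ℝ (Fin 3) → EuclideanSpace ℝ (Fin 3)}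
    {w : ℝ → EuclideanSpace ℝ (Fin 3) → EuclideanSpace ℝ (Fin 3)}
    {ϖ : ℝ → EuclideanSpace ℝ (Fin 3) → ℝ} (h : IsLocalLeraySolutionOn (ν * T) 1 (ν⁻¹ • v₀) w ϖ)
    (hν : 0 < ν) :
    IsLocalLeraySolutionOn T ν v₀ (FluidPDE.timeRescale ν ν w) (FluidPDE.timeRescale ν (ν ^ 2) ϖ) := by
  have h1 := h.timeRescale hν
  rwa [mul_one, smul_smul, mul_inv_cancel₀ hν.ne', one_smul] at h1

/-- The two normalisations are inverse to each other on the velocity: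
`ν • (ν⁻¹ v(ν⁻¹ ·, ·))(ν ·, ·) = v`. [folklore] -/
theorem timeRescale_timeRescale_inv {ν : ℝ} (hν : ν ≠ 0)
    (v : ℝ → EuclideanSpace ℝ (Fin 3) → EuclideanSpace ℝ (Fin 3)) :
    FluidPDE.timeRescale ν ν (FluidPDE.timeRescale ν⁻¹ ν⁻¹ v) = v := by
  funext s y
  simp [timeRescale_apply, smul_smul, mul_inv_cancel₀ hν, ← mul_assoc, inv_mul_cancel₀ hν]

end Literature.Analysis.FluidPDE

end
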